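import Mathlib
import Literature.MathematicalPhysics.QuantumLattice.HubbardBandSectorCountingToolbox
import Summits.HubbardSuperconductivity.HubbardSuperconductivity.Theorems.KLProgrammeKLRegimeTwoPointLimitShellTransversality
import Summits.HubbardSuperconductivity.HubbardSuperconductivity.Theorems.KLProgrammeKLRegimeTwoPointLimitShellSecondOrder
import Summits.HubbardSuperconductivity.HubbardSuperconductivity.Theorems.KLProgrammeKLRegimeTwoPointLimitShellCountTools
import Summits.HubbardSuperconductivity.HubbardSuperconductivity.Theorems.KLProgrammeKLRegimeTwoPointLimitShellCountCooper
import HarnessLib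

/-!
# Route `KLProgramme` — crux K3 `KLRegimeTwoPointLimit` (stmt-HubbardSuperconductivity-19937), support:
# the intersection count away from the Cooper point (DECOMP App. E Lemmas E.1 / E.3)

Cell `gate-hubbard-kl`, seat p1b; paper note `HOME/prover-p1b/E1-NOTE.md` §3 Lemma 7 (ii). When the
transfer `w` keeps torus distance `≥ v` from `2πℤ²`, the zeros of `G_w(θ) = ε(p_μ(θ) - w) - μ` in a
period number `≤ 2π/ℓ + 25` (`klsd_zeros_card_le_awayFromCooper`): a critical point `c` with
`|G_w(c)| ≤ η` is odd-aligned, `2p_μ(c)` within `ρ₁(η)` of a caustic translate `w - 2πm`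
(`klsd_bad_point_near_caustic`, from `klst_transversality_alternative` at `λ = 0`); zeros `≥ ℓ` away
from all such points are `ℓ`-separated (Rolle); the others have `2p_μ` within `ρ₂` of one of `≤ 4`
translates, and for each translate lie in three short windows on which `G_w'' > 0`
(`klsc_second_deriv_lower_bound`), two zeros each (`klsd_nearCaustic_zeros_card_le_six`). All
smallness conditions are explicit inequalities in `ℓ, η, ρ₂` and the fields of `BandBounds`.
Not here: the angular / area assembly of Lemma E.1/E.3.
-/

noncomputable section

-- the tree's namespace `Summit.<Summit>.<Problem>.Theorems` repeats the summit name by design (D-0017)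
set_option linter.dupNamespace false

open Real Set
open Literature.MathematicalPhysics.QuantumLattice
open Literature.MathematicalPhysics.QuantumLattice.BandSectorCounting

namespace Summit.HubbardSuperconductivity.HubbardSuperconductivity.Theorems

section Main

variable {a b : ℝ} (B : BandBounds a b) {μ : ℝ} (hμ : μ ∈ Icc a b)
include B hμ

/-! ### Bad critical points sit at the caustic -/

/-- **A bad critical point is odd-aligned.** If `w` keeps torus sup-distance `≥ v` from `2πℤ²`
and `η` is small, then at every critical point `c` of the translated level function with
`|G_w(c)| ≤ η`, `2p_μ(c)` is within `ρ₁(η) = s_max D + (A₂/4)D² + η/Dt_min` (`D = 2C_g s_max η/Dt_min`)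
of a caustic translate `w - 2πm`. -/
theorem klsd_bad_point_near_caustic {η v w₁ w₂ c : ℝ}
    (hlo : a ≤ μ - η) (hhi : μ + η ≤ b)
    (hv : ∀ m₀ m₁ : ℤ, v ≤ max |w₁ - m₀ * (2 * π)| |w₂ - m₁ * (2 * π)|)
    (hH1 : B.smax * (B.Cg * (2 * B.smax * (η / B.Dtmin))) + η / B.Dtmin < v)
    (hG : |eps2 (bandX μ c - w₁) (bandY μ c - w₂) - μ| ≤ η)
    (hG' : Real.sin (bandX μ c - w₁) * bandVX μ c + Real.sin (bandY μ c - w₂) * bandVY μ c = 0) :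
    ∃ m₀ m₁ : ℤ, max |2 * bandX μ c - (w₁ - m₀ * (2 * π))| |2 * bandY μ c - (w₂ - m₁ * (2 * π))| ≤
      B.smax * (B.Cg * (2 * B.smax * (η / B.Dtmin))) +
        B.A2 / 4 * (B.Cg * (2 * B.smax * (η / B.Dtmin))) ^ 2 + η / B.Dtmin := by
  have hG'0 : |Real.sin (bandX μ c - w₁) * bandVX μ c + Real.sin (bandY μ c - w₂) * bandVY μ c| ≤ 0 := by
    rw [hG', abs_zero]
  obtain ⟨m₀, m₁, d, hd, halt⟩ := klst_transversality_alternative B hμ hlo hhi hG hG'0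
  rw [zero_add] at hd
  set D := B.Cg * (2 * B.smax * (η / B.Dtmin)) with hD
  have hD0 : 0 ≤ D := (abs_nonneg d).trans hd
  have hsd : B.smax * |d| ≤ B.smax * D := mul_le_mul_of_nonneg_left hd B.smax_pos.le
  rcases halt with ⟨hx, hy⟩ | ⟨hx, hy⟩
  · -- even alignment contradicts the distance to the lattice
    exfalso
    have := hv m₀ m₁
    have hmax := max_le hx hy
    linarith
  · refine ⟨m₀, m₁, ?_⟩
    have hd2 : d ^ 2 ≤ D ^ 2 := by
      rw [← sq_abs d]; exact pow_le_pow_left₀ (abs_nonneg d) hd 2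
    have hA := B.A2_pos
    have hAd : B.A2 / 4 * d ^ 2 ≤ B.A2 / 4 * D ^ 2 := mul_le_mul_of_nonneg_left hd2 (by linarith)
    have hLX := abs_bandX_sub_le B hμ (c + d / 2) c
    have hLY := abs_bandY_sub_le B hμ (c + d / 2) c
    rw [show c + d / 2 - c = d / 2 by ring] at hLX hLY
    have hd2' : |d / 2| = |d| / 2 := by rw [abs_div, abs_two]
    rw [hd2'] at hLX hLY
    refine max_le ?_ ?_
    · have e : 2 * bandX μ c - (w₁ - m₀ * (2 * π)) =
          -(w₁ - m₀ * (2 * π) - 2 * bandX μ (c + d / 2)) - 2 * (bandX μ (c + d / 2) - bandX μ c) := by ring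
      rw [e]
      calc |-(w₁ - m₀ * (2 * π) - 2 * bandX μ (c + d / 2)) - 2 * (bandX μ (c + d / 2) - bandX μ c)|
          ≤ |-(w₁ - m₀ * (2 * π) - 2 * bandX μ (c + d / 2))| + |2 * (bandX μ (c + d / 2) - bandX μ c)| :=
            abs_sub _ _
        _ ≤ (B.A2 / 4 * d ^ 2 + η / B.Dtmin) + 2 * (B.smax * (|d| / 2)) := by
            rw [abs_neg, abs_mul, abs_two]; exact add_le_add hx (by linarith)
        _ ≤ _ := by nlinarith
    · have e : 2 * bandY μ c - (w₂ - m₁ * (2 * π)) =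
          -(w₂ - m₁ * (2 * π) - 2 * bandY μ (c + d / 2)) - 2 * (bandY μ (c + d / 2) - bandY μ c) := by ring
      rw [e]
      calc |-(w₂ - m₁ * (2 * π) - 2 * bandY μ (c + d / 2)) - 2 * (bandY μ (c + d / 2) - bandY μ c)|
          ≤ |-(w₂ - m₁ * (2 * π) - 2 * bandY μ (c + d / 2))| + |2 * (bandY μ (c + d / 2) - bandY μ c)| :=
            abs_sub _ _
        _ ≤ (B.A2 / 4 * d ^ 2 + η / B.Dtmin) + 2 * (B.smax * (|d| / 2)) := by
            rw [abs_neg, abs_mul, abs_two]; exact add_le_add hy (by linarith)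
        _ ≤ _ := by nlinarith

/-- **Two zeros per window.** On an interval where `2p_μ(θ)` stays within `ρ₃` of the caustic
translate `w - 2πm`, `(4 s_max² + 4A₂)ρ₃ < 4h_min`, `G_w` is strictly convex: at most two zeros. -/
theorem klsd_window_zeros_card_le_two {w₁ w₂ x y ρ₃ : ℝ} (m₀ m₁ : ℤ)
    (hρ₃ : (4 * B.smax ^ 2 + 4 * B.A2) * ρ₃ < 4 * B.hmin)
    (hwin : ∀ θ ∈ Icc x y,
      max |2 * bandX μ θ - (w₁ - m₀ * (2 * π))| |2 * bandY μ θ - (w₂ - m₁ * (2 * π))| ≤ ρ₃) :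
    ∃ Z : Finset ℝ, Z.card ≤ 2 ∧
      ∀ z ∈ Icc x y, eps2 (bandX μ z - w₁) (bandY μ z - w₂) = μ → z ∈ Z := by
  obtain ⟨h1, h2⟩ := B.level hμ
  set G : ℝ → ℝ := fun t => eps2 (bandX μ t - w₁) (bandY μ t - w₂) - μ with hG
  set G' : ℝ → ℝ := fun t =>
    2 * (Real.sin (bandX μ t - w₁) * bandVX μ t + Real.sin (bandY μ t - w₂) * bandVY μ t) with hG'
  set G'' : ℝ → ℝ := fun t =>
    2 * (Real.cos (bandX μ t - w₁) * bandVX μ t ^ 2 + Real.sin (bandX μ t - w₁) * bandAX μ t +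
      Real.cos (bandY μ t - w₂) * bandVY μ t ^ 2 + Real.sin (bandY μ t - w₂) * bandAY μ t) with hG''
  have hGd : ∀ t, HasDerivAt G (G' t) t := fun t => (klst_hasDerivAt_transLevel h1 h2 w₁ w₂ t).sub_const μ
  have hG'd : ∀ t, HasDerivAt G' (G'' t) t := fun t => klsc_hasDerivAt_transLevelDeriv h1 h2 w₁ w₂ t
  have hpos : ∀ t ∈ Icc x y, 0 < G'' t := by
    intro t ht
    have hlb := klsc_second_deriv_lower_bound B hμ w₁ w₂ t m₀ m₁
    have hw := hwin t ht
    have hc : 0 ≤ 4 * B.smax ^ 2 + 4 * B.A2 := by nlinarith [B.smax_pos, B.A2_pos]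
    have := mul_le_mul_of_nonneg_left hw hc
    show 0 < 2 * (Real.cos (bandX μ t - w₁) * bandVX μ t ^ 2 + Real.sin (bandX μ t - w₁) * bandAX μ t +
      Real.cos (bandY μ t - w₂) * bandVY μ t ^ 2 + Real.sin (bandY μ t - w₂) * bandAY μ t)
    linarith
  have hmono : StrictMonoOn G' (Icc x y) :=
    strictMonoOn_of_deriv_pos (convex_Icc x y)
      (fun t _ => (hG'd t).continuousAt.continuousWithinAt)
      (fun t ht => by rw [(hG'd t).deriv]; exact hpos t (interior_subset ht))
  obtain ⟨Z, hZ, hmem⟩ := klsk_zeros_subset_pair_of_strictMonoOn_deriv hGd hmono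
  refine ⟨Z, hZ, fun z hz hGz => hmem z hz ?_⟩
  show eps2 (bandX μ z - w₁) (bandY μ z - w₂) - μ = 0
  rw [hGz, sub_self]

/-- If two curve points are within `ρ` in sup-norm, their angles are within
`π ρ/(√2 u_min)` modulo `2π` (`chord_lower` and Jordan's inequality). -/
theorem klsd_exists_int_near_of_close {θ ζ ρ : ℝ}
    (h : max |bandX μ θ - bandX μ ζ| |bandY μ θ - bandY μ ζ| ≤ ρ) :
    ∃ k : ℤ, |θ - ζ - k * (2 * π)| ≤ π * (ρ / (Real.sqrt 2 * B.umin)) := by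
  have hu := B.umin_pos
  have hρ0 : 0 ≤ ρ := (le_max_left _ _).trans' (abs_nonneg _) |>.trans h
  have hch := chord_lower B hμ θ ζ
  have hX := (abs_le.1 ((le_max_left _ _).trans h))
  have hY := (abs_le.1 ((le_max_right _ _).trans h))
  have hsq : (bandX μ θ - bandX μ ζ) ^ 2 + (bandY μ θ - bandY μ ζ) ^ 2 ≤ 2 * ρ ^ 2 := by nlinarith
  have hsin2 : Real.sin ((θ - ζ) / 2) ^ 2 ≤ (ρ / (Real.sqrt 2 * B.umin)) ^ 2 := by
    rw [div_pow, mul_pow, Real.sq_sqrt (by norm_num : (0:ℝ) ≤ 2)]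
    rw [le_div_iff₀ (by positivity)]
    nlinarith
  have hsin : |Real.sin ((θ - ζ) / 2)| ≤ ρ / (Real.sqrt 2 * B.umin) := by
    have h0 : 0 ≤ ρ / (Real.sqrt 2 * B.umin) := by positivity
    exact abs_le_of_sq_le_sq' hsin2 h0 |> fun h => abs_le.2 h
  obtain ⟨k, hk⟩ := klcc_exists_int_abs_sub_mul_pi_le ((θ - ζ) / 2)
  refine ⟨k, ?_⟩
  have e : θ - ζ - k * (2 * π) = 2 * ((θ - ζ) / 2 - k * π) := by ring
  rw [e, abs_mul, abs_two]
  have := mul_le_mul_of_nonneg_left hsin (by positivity : (0:ℝ) ≤ π / 2)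
  nlinarith [hk, this, Real.pi_pos]

/-- **Six zeros per caustic translate.** For a lattice vector `m`, the zeros `z` in a period at
which `2p_μ(z)` is within `ρ₂` of `w - 2πm` number at most six, provided `ρ₂/(√2 u_min) < 2` and the
windows of half-width `π ρ₂/(√2 u_min)` are convex (all such zeros are within the window of any one
of them modulo `2π`: three windows of the period, two zeros each). -/
theorem klsd_nearCaustic_zeros_card_le_six {w₁ w₂ θ₀ ρ₂ : ℝ} (m₀ m₁ : ℤ)
    (hσ : ρ₂ / (Real.sqrt 2 * B.umin) < 2)
    (hconv : (4 * B.smax ^ 2 + 4 * B.A2) * (2 * B.smax * (π * (ρ₂ / (Real.sqrt 2 * B.umin))) + ρ₂) <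
      4 * B.hmin) :
    ∃ Z : Finset ℝ, Z.card ≤ 6 ∧
      ∀ z ∈ Icc θ₀ (θ₀ + 2 * π), eps2 (bandX μ z - w₁) (bandY μ z - w₂) = μ →
        max |2 * bandX μ z - (w₁ - m₀ * (2 * π))| |2 * bandY μ z - (w₂ - m₁ * (2 * π))| ≤ ρ₂ → z ∈ Z := by
  classical
  obtain ⟨h1, h2⟩ := B.level hμ
  have hπ := Real.pi_pos
  set W := π * (ρ₂ / (Real.sqrt 2 * B.umin)) with hW
  by_cases hex : ∃ ζ ∈ Icc θ₀ (θ₀ + 2 * π), eps2 (bandX μ ζ - w₁) (bandY μ ζ - w₂) = μ ∧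
      max |2 * bandX μ ζ - (w₁ - m₀ * (2 * π))| |2 * bandY μ ζ - (w₂ - m₁ * (2 * π))| ≤ ρ₂
  · obtain ⟨ζ, hζP, -, hζw⟩ := hex
    have hρ₂0 : 0 ≤ ρ₂ := le_trans (le_trans (abs_nonneg _) (le_max_left _ _)) hζw
    -- the three windows around `ζ + 2kπ`, `k = -1, 0, 1`
    have hwin : ∀ k : ℤ, ∀ θ ∈ Icc (ζ + k * (2 * π) - W) (ζ + k * (2 * π) + W),
        max |2 * bandX μ θ - (w₁ - m₀ * (2 * π))| |2 * bandY μ θ - (w₂ - m₁ * (2 * π))| ≤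
          2 * B.smax * W + ρ₂ := by
      intro k θ hθ
      have hper := band_add_int_mul_two_pi h1 h2 ζ k
      have hLX := abs_bandX_sub_le B hμ θ (ζ + k * (2 * π))
      have hLY := abs_bandY_sub_le B hμ θ (ζ + k * (2 * π))
      rw [hper.1] at hLX
      rw [hper.2.1] at hLY
      have hdist : |θ - (ζ + k * (2 * π))| ≤ W := by
        rw [abs_le]; constructor <;> linarith [hθ.1, hθ.2]
      obtain ⟨hζX1, hζX2⟩ := abs_le.1 ((le_max_left _ _).trans hζw)
      obtain ⟨hζY1, hζY2⟩ := abs_le.1 ((le_max_right _ _).trans hζw)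
      obtain ⟨hLX1, hLX2⟩ := abs_le.1 (hLX.trans (mul_le_mul_of_nonneg_left hdist B.smax_pos.le))
      obtain ⟨hLY1, hLY2⟩ := abs_le.1 (hLY.trans (mul_le_mul_of_nonneg_left hdist B.smax_pos.le))
      refine max_le ?_ ?_ <;> (rw [abs_le]; constructor <;> linarith)
    have hρ₃ : (4 * B.smax ^ 2 + 4 * B.A2) * (2 * B.smax * W + ρ₂) < 4 * B.hmin := hconv
    have hZk : ∀ k : ℤ, ∃ Z : Finset ℝ, Z.card ≤ 2 ∧
        ∀ z ∈ Icc (ζ + k * (2 * π) - W) (ζ + k * (2 * π) + W),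
          eps2 (bandX μ z - w₁) (bandY μ z - w₂) = μ → z ∈ Z :=
      fun k => klsd_window_zeros_card_le_two B hμ m₀ m₁ hρ₃ (hwin k)
    choose Zk hZk_card hZk_mem using hZk
    refine ⟨Zk (-1) ∪ Zk 0 ∪ Zk 1, ?_, ?_⟩
    · calc (Zk (-1) ∪ Zk 0 ∪ Zk 1).card ≤ (Zk (-1) ∪ Zk 0).card + (Zk 1).card := Finset.card_union_le _ _
        _ ≤ ((Zk (-1)).card + (Zk 0).card) + (Zk 1).card := by gcongr; exact Finset.card_union_le _ _
        _ ≤ (2 + 2) + 2 := by gcongr <;> exact hZk_card _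
        _ = 6 := by norm_num
    · intro z hzP hGz hzw
      -- `p(z)` and `p(ζ)` are within `ρ₂`
      have hclose : max |bandX μ z - bandX μ ζ| |bandY μ z - bandY μ ζ| ≤ ρ₂ := by
        obtain ⟨h1a, h1b⟩ := abs_le.1 ((le_max_left _ _).trans hzw)
        obtain ⟨h2a, h2b⟩ := abs_le.1 ((le_max_right _ _).trans hzw)
        obtain ⟨h3a, h3b⟩ := abs_le.1 ((le_max_left _ _).trans hζw)
        obtain ⟨h4a, h4b⟩ := abs_le.1 ((le_max_right _ _).trans hζw)
        refine max_le ?_ ?_ <;> (rw [abs_le]; constructor <;> linarith)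
      obtain ⟨k, hk⟩ := klsd_exists_int_near_of_close B hμ hclose
      -- `|k| ≤ 1` since both angles lie in the same period and `W < 2π`
      have hWlt : W < 2 * π := by
        rw [hW]; nlinarith [hσ, hπ]
      have hzζ : |z - ζ| ≤ 2 * π := by
        rw [abs_le]; constructor <;> linarith [hzP.1, hzP.2, hζP.1, hζP.2]
      have hkabs : |(k : ℝ)| < 2 := by
        have h3 : |(k : ℝ) * (2 * π)| ≤ |z - ζ| + W := by
          have e : (k : ℝ) * (2 * π) = (z - ζ) - (z - ζ - k * (2 * π)) := by ring
          calc |(k : ℝ) * (2 * π)| = |(z - ζ) - (z - ζ - k * (2 * π))| := by rw [← e]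
            _ ≤ |z - ζ| + |z - ζ - k * (2 * π)| := abs_sub _ _
            _ ≤ |z - ζ| + W := by linarith [hk]
        rw [abs_mul, abs_of_pos (by positivity : (0:ℝ) < 2 * π)] at h3
        have h4 : |(k : ℝ)| * (2 * π) < 2 * (2 * π) := by linarith
        exact lt_of_mul_lt_mul_right h4 (by positivity)
      have hk2 : -2 < k ∧ k < 2 := by
        rw [abs_lt] at hkabs
        exact ⟨by exact_mod_cast hkabs.1, by exact_mod_cast hkabs.2⟩
      have hzI : z ∈ Icc (ζ + k * (2 * π) - W) (ζ + k * (2 * π) + W) := by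
        rw [abs_le] at hk; constructor <;> linarith [hk.1, hk.2]
      have hzmem := hZk_mem k z hzI hGz
      rcases hk2 with ⟨hk1, hk3⟩
      interval_cases k
      · exact Finset.mem_union_left _ (Finset.mem_union_left _ (by simpa using hzmem))
      · exact Finset.mem_union_left _ (Finset.mem_union_right _ (by simpa using hzmem))
      · exact Finset.mem_union_right _ (by simpa using hzmem)
  · refine ⟨∅, by simp, ?_⟩
    intro z hz hGz hzw
    exact (hex ⟨z, hz, hGz, hzw⟩).elim

/-! ### The count away from the Cooper point -/

omit B hμ in
/-- Integers within `< 1` of a real `t` are `⌊t⌋` or `⌊t⌋ + 1`. -/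
theorem klsd_int_mem_pair_of_abs_sub_lt_one {t : ℝ} {n : ℤ} (h : |t - n| < 1) :
    n ∈ ({⌊t⌋, ⌊t⌋ + 1} : Finset ℤ) := by
  rw [abs_lt] at h
  have h1 : (⌊t⌋ : ℝ) ≤ t := Int.floor_le t
  have h2 : t < (⌊t⌋ : ℝ) + 1 := Int.lt_floor_add_one t
  have h3 : (⌊t⌋ : ℝ) < (n : ℝ) + 1 := by linarith
  have h4 : (n : ℝ) < (⌊t⌋ : ℝ) + 2 := by linarith
  have h3' : ⌊t⌋ < n + 1 := by exact_mod_cast h3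
  have h4' : n < ⌊t⌋ + 2 := by exact_mod_cast h4
  rw [Finset.mem_insert, Finset.mem_singleton]
  omega

/-- **The intersection count away from the Cooper point.** Let `w` keep torus sup-distance `≥ v`
from `2πℤ²`, `ℓ > 0`, `η ≥ 4 s_max ℓ` with `μ ± η` in the level range, `ρ₂ ≥ ρ₁(η) + 2 s_max ℓ`
satisfying the window conditions and `2K(μ) + ρ₂ < 2π` (at most four caustic translates in reach),
and the even-exclusion condition. Then `F_μ + w` meets `F_μ` in at most `2π/ℓ + 25` points per
period: zeros `≥ ℓ` from every bad point are `ℓ`-separated (`≤ 2π/ℓ + 1`), the others lie within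
`ρ₂` of one of `≤ 4` caustic translates (`≤ 6` each). -/
theorem klsd_zeros_card_le_awayFromCooper {η v ℓ ρ₂ w₁ w₂ θ₀ : ℝ}
    (hlo : a ≤ μ - η) (hhi : μ + η ≤ b) (hℓ : 0 < ℓ) (hηℓ : 4 * B.smax * ℓ ≤ η)
    (hv : ∀ m₀ m₁ : ℤ, v ≤ max |w₁ - m₀ * (2 * π)| |w₂ - m₁ * (2 * π)|)
    (hH1 : B.smax * (B.Cg * (2 * B.smax * (η / B.Dtmin))) + η / B.Dtmin < v)
    (hρ₂ : B.smax * (B.Cg * (2 * B.smax * (η / B.Dtmin))) +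
        B.A2 / 4 * (B.Cg * (2 * B.smax * (η / B.Dtmin))) ^ 2 + η / B.Dtmin + 2 * B.smax * ℓ ≤ ρ₂)
    (hσ : ρ₂ / (Real.sqrt 2 * B.umin) < 2)
    (hconv : (4 * B.smax ^ 2 + 4 * B.A2) * (2 * B.smax * (π * (ρ₂ / (Real.sqrt 2 * B.umin))) + ρ₂) <
      4 * B.hmin)
    (hH4 : 2 * umklappRadius μ + ρ₂ < 2 * π) :
    ∃ Z : Finset ℝ, (Z.card : ℝ) ≤ 2 * π / ℓ + 25 ∧
      ∀ z ∈ Icc θ₀ (θ₀ + 2 * π), eps2 (bandX μ z - w₁) (bandY μ z - w₂) = μ → z ∈ Z := by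
  classical
  obtain ⟨h1, h2⟩ := B.level hμ
  have hπ := Real.pi_pos
  set G : ℝ → ℝ := fun t => eps2 (bandX μ t - w₁) (bandY μ t - w₂) - μ with hG
  set G' : ℝ → ℝ := fun t =>
    2 * (Real.sin (bandX μ t - w₁) * bandVX μ t + Real.sin (bandY μ t - w₂) * bandVY μ t) with hG'
  have hGd : ∀ t, HasDerivAt G (G' t) t := fun t => (klst_hasDerivAt_transLevel h1 h2 w₁ w₂ t).sub_const μ
  -- `|G'| ≤ 4 s_max`
  have hM : ∀ t, |G' t| ≤ 4 * B.smax := by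
    intro t
    have hs1 : |Real.sin (bandX μ t - w₁) * bandVX μ t| ≤ B.smax := by
      rw [abs_mul]; exact (mul_le_mul (Real.abs_sin_le_one _) (B.abs_VX_le μ hμ t) (abs_nonneg _)
        zero_le_one).trans (by linarith)
    have hs2 : |Real.sin (bandY μ t - w₂) * bandVY μ t| ≤ B.smax := by
      rw [abs_mul]; exact (mul_le_mul (Real.abs_sin_le_one _) (B.abs_VY_le μ hμ t) (abs_nonneg _)
        zero_le_one).trans (by linarith)
    show |2 * (Real.sin (bandX μ t - w₁) * bandVX μ t + Real.sin (bandY μ t - w₂) * bandVY μ t)| ≤ 4 * B.smax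
    rw [abs_mul, abs_two]
    linarith [abs_add_le (Real.sin (bandX μ t - w₁) * bandVX μ t) (Real.sin (bandY μ t - w₂) * bandVY μ t)]
  set P := Icc θ₀ (θ₀ + 2 * π) with hP
  set ZS : Set ℝ := {z ∈ P | eps2 (bandX μ z - w₁) (bandY μ z - w₂) = μ} with hZS
  -- the far zeros
  set Zfar : Set ℝ := {z ∈ P | eps2 (bandX μ z - w₁) (bandY μ z - w₂) = μ ∧
      ∀ c ∈ P, G' c = 0 → |G c| ≤ η → ℓ ≤ |z - c|} with hZfar
  have hfar_sep : ∀ z ∈ Zfar, ∀ z' ∈ Zfar, z < z' → ℓ ≤ z' - z := by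
    intro z hz z' hz' hzz'
    by_contra hlt
    push Not at hlt
    have hGz : G z = 0 := by show eps2 (bandX μ z - w₁) (bandY μ z - w₂) - μ = 0; rw [hz.2.1, sub_self]
    have hGz' : G z' = 0 := by show eps2 (bandX μ z' - w₁) (bandY μ z' - w₂) - μ = 0; rw [hz'.2.1, sub_self]
    obtain ⟨c, hc, hc0, hGc⟩ := klsk_exists_critical_between hGd hM hzz' hGz hGz'
    have hcP : c ∈ P := ⟨le_trans hz.1.1 hc.1.le, le_trans hc.2.le hz'.1.2⟩
    have hGcη : |G c| ≤ η := hGc.trans ((mul_le_mul_of_nonneg_left hlt.le (by linarith [B.smax_pos])).trans hηℓ)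
    have hfar := hz.2.2 c hcP hc0 hGcη
    rw [abs_of_neg (by linarith [hc.1] : z - c < 0)] at hfar
    linarith [hc.2]
  obtain ⟨hZfar_fin, hZfar_card⟩ :=
    klsk_finite_ncard_le_of_separated hℓ (by linarith : θ₀ ≤ θ₀ + 2 * π) (fun z hz => hz.1) hfar_sep
  rw [show θ₀ + 2 * π - θ₀ = 2 * π by ring] at hZfar_card
  -- the near zeros: per caustic translate
  have hsix : ∀ m₀ m₁ : ℤ, ∃ Z : Finset ℝ, Z.card ≤ 6 ∧
      ∀ z ∈ Icc θ₀ (θ₀ + 2 * π), eps2 (bandX μ z - w₁) (bandY μ z - w₂) = μ →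
        max |2 * bandX μ z - (w₁ - m₀ * (2 * π))| |2 * bandY μ z - (w₂ - m₁ * (2 * π))| ≤ ρ₂ → z ∈ Z :=
    fun m₀ m₁ => klsd_nearCaustic_zeros_card_le_six B hμ m₀ m₁ hσ hconv
  choose Zm hZm_card hZm_mem using hsix
  set n₁ : ℤ := ⌊w₁ / (2 * π)⌋ with hn₁
  set n₂ : ℤ := ⌊w₂ / (2 * π)⌋ with hn₂
  set Mfin : Finset (ℤ × ℤ) := ({n₁, n₁ + 1} : Finset ℤ) ×ˢ ({n₂, n₂ + 1} : Finset ℤ) with hMfin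
  have hMcard : Mfin.card ≤ 4 := by
    rw [hMfin, Finset.card_product]
    have h1' : ({n₁, n₁ + 1} : Finset ℤ).card ≤ 2 := Finset.card_le_two
    have h2' : ({n₂, n₂ + 1} : Finset ℤ).card ≤ 2 := Finset.card_le_two
    calc ({n₁, n₁ + 1} : Finset ℤ).card * ({n₂, n₂ + 1} : Finset ℤ).card ≤ 2 * 2 :=
          Nat.mul_le_mul h1' h2'
      _ = 4 := by norm_num
  set Znear : Finset ℝ := Mfin.biUnion (fun m => Zm m.1 m.2) with hZnear
  have hZnear_card : Znear.card ≤ 24 := by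
    calc Znear.card ≤ ∑ m ∈ Mfin, (Zm m.1 m.2).card := Finset.card_biUnion_le
      _ ≤ ∑ _m ∈ Mfin, 6 := Finset.sum_le_sum (fun m _ => hZm_card m.1 m.2)
      _ = Mfin.card * 6 := by rw [Finset.sum_const, smul_eq_mul]
      _ ≤ 4 * 6 := by gcongr
      _ = 24 := by norm_num
  refine ⟨hZfar_fin.toFinset ∪ Znear, ?_, ?_⟩
  · have hc := Finset.card_union_le hZfar_fin.toFinset Znear
    have h1' : (hZfar_fin.toFinset.card : ℝ) ≤ 2 * π / ℓ + 1 := by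
      rw [← Set.ncard_eq_toFinset_card Zfar hZfar_fin]; exact hZfar_card
    have h2' : (Znear.card : ℝ) ≤ 24 := by exact_mod_cast hZnear_card
    have hc' : ((hZfar_fin.toFinset ∪ Znear).card : ℝ) ≤ hZfar_fin.toFinset.card + Znear.card := by
      exact_mod_cast hc
    linarith
  · intro z hzP hGz
    by_cases hfar : ∀ c ∈ P, G' c = 0 → |G c| ≤ η → ℓ ≤ |z - c|
    · apply Finset.mem_union_left
      rw [Set.Finite.mem_toFinset]
      exact ⟨hzP, hGz, hfar⟩
    · apply Finset.mem_union_right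
      push Not at hfar
      obtain ⟨c, hcP, hc0, hGc, hzc⟩ := hfar
      -- the bad point `c` is at a caustic translate
      have hc0' : Real.sin (bandX μ c - w₁) * bandVX μ c + Real.sin (bandY μ c - w₂) * bandVY μ c = 0 := by
        have : G' c = 2 * (Real.sin (bandX μ c - w₁) * bandVX μ c +
          Real.sin (bandY μ c - w₂) * bandVY μ c) := rfl
        rw [this] at hc0; linarith
      obtain ⟨m₀, m₁, hm⟩ := klsd_bad_point_near_caustic B hμ hlo hhi hv hH1 hGc hc0'
      -- hence `2p(z)` is within `ρ₂` of the same translate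
      have hLX := abs_bandX_sub_le B hμ z c
      have hLY := abs_bandY_sub_le B hμ z c
      have hzc' := hzc.le
      have hzw : max |2 * bandX μ z - (w₁ - m₀ * (2 * π))| |2 * bandY μ z - (w₂ - m₁ * (2 * π))| ≤ ρ₂ := by
        obtain ⟨hmX1, hmX2⟩ := abs_le.1 ((le_max_left _ _).trans hm)
        obtain ⟨hmY1, hmY2⟩ := abs_le.1 ((le_max_right _ _).trans hm)
        obtain ⟨hLX1, hLX2⟩ := abs_le.1 (hLX.trans (mul_le_mul_of_nonneg_left hzc' B.smax_pos.le))
        obtain ⟨hLY1, hLY2⟩ := abs_le.1 (hLY.trans (mul_le_mul_of_nonneg_left hzc' B.smax_pos.le))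
        refine max_le ?_ ?_ <;> (rw [abs_le]; constructor <;> linarith [hρ₂])
      -- the translate is one of the four in reach
      have h2π : (0 : ℝ) < 2 * π := by positivity
      have hnear : ∀ (wc X : ℝ) (n : ℤ), |X| ≤ umklappRadius μ → |2 * X - (wc - n * (2 * π))| ≤ ρ₂ →
          |wc / (2 * π) - n| < 1 := by
        intro wc X n hX hwX
        obtain ⟨hX1, hX2⟩ := abs_le.1 hX
        obtain ⟨hw1, hw2⟩ := abs_le.1 hwX
        have hlt : |wc - n * (2 * π)| < 2 * π := by
          rw [abs_lt]; constructor <;> linarith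
        have e : wc / (2 * π) - n = (wc - n * (2 * π)) / (2 * π) := by
          field_simp
        rw [e, abs_div, abs_of_pos h2π, div_lt_one h2π]
        exact hlt
      have hm₀ : m₀ ∈ ({n₁, n₁ + 1} : Finset ℤ) :=
        klsd_int_mem_pair_of_abs_sub_lt_one
          (hnear w₁ (bandX μ z) m₀ (abs_bandX_le_umklappRadius h1 h2 z) ((le_max_left _ _).trans hzw))
      have hm₁ : m₁ ∈ ({n₂, n₂ + 1} : Finset ℤ) :=
        klsd_int_mem_pair_of_abs_sub_lt_one
          (hnear w₂ (bandY μ z) m₁ (abs_bandY_le_umklappRadius h1 h2 z) ((le_max_right _ _).trans hzw))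
      have hmM : (m₀, m₁) ∈ Mfin := Finset.mem_product.2 ⟨hm₀, hm₁⟩
      rw [hZnear, Finset.mem_biUnion]
      exact ⟨(m₀, m₁), hmM, hZm_mem m₀ m₁ z hzP hGz hzw⟩

end Main

end Summit.HubbardSuperconductivity.HubbardSuperconductivity.Theorems

end
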